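import Summits.CriticalPhenomena.PercolationContinuityZ3.Theorems.PercNearOneGluingNoHeavyLowerTailSahiTransportCert
import Summits.CriticalPhenomena.PercolationContinuityZ3.Theorems.SahiConjecture
import Literature.Probability.LatticeModels.StrassenHolleyCoupling

/-!
# `NoHeavyLowerTail` (crux stmt-CriticalPhenomena-4575), Sahi / Kahn positivity: TRANSPORT CERTIFICATES (III) —
# the reduced (`ρ`-form) certificate, its equivalence with the kernel form (Strassen), and the transport-certificate conjecture

Support file (cell `prim-l12`, seat P3, gen 5; `--supports stmt-CriticalPhenomena-4575`).  No `sorry`, no named facts, standard axioms.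
New mathematics (the objects are this programme's; the coupling step is Strassen's theorem, imported from `Literature`).

`…SahiTransportCert` proved: a TRANSPORT CERTIFICATE — a kernel `Π ≥ 0` on `{S ⊆ T, S ∉ H_k, T ∈ H_k}` with row sums `θ w(S)`,
column sums `≤ (2 − θ) w(T)` and the transport condition (TC) on pairs of up-sets of the pattern cube — gives Kahn's Conjecture 5 /
Sahi's `C₃` for the junta first slot `H` and ALL increasing `U, V` in every dimension (`sahiE_three_nonneg_of_transportCert`).
The kernel enters (TC) and the column bound only through its column marginal.  Writing `ρ = Π(H_kᶜ, ·)/(θδ)` (`θ = w(H_k)`,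
`δ = 1 − θ`), a probability vector on `H_k`, the certificate is EQUIVALENT (for `0 < θ < 1`) to the finite linear system
  (o)  `ρ ≥st μ(· | H_kᶜ)`:      `w(H_kᶜ ∩ 𝒯) ≤ δ · ρ(𝒯)` for every up-set `𝒯` (Strassen: this is exactly the existence of the coupling `Π`);
  (a)  capacity:                 `θ δ ρ(T) ≤ (2 − θ) w(T)`;
  (TC) for all up-sets `𝒳, 𝒵`:  `θ δ ρ(𝒳 ∩ 𝒵) ≤ (2−θ)[w(𝒳∩𝒵) − w(𝒳)w(𝒵) − w(H_kᶜ∩𝒳∩𝒵)] + w(𝒳)w(H_kᶜ∩𝒵) + w(𝒵)w(H_kᶜ∩𝒳)`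
(`RhoCert`; `exists_transportCert_of_rhoCert`, `exists_rhoCert_of_transportCert`, `exists_transportCert_iff_exists_rhoCert`).  This is the
linear programme whose exact feasibility was censused (seat kit j101506/j101795, ttrl2 cp-tcert: every nontrivial up-set of `2^3` and `2^4`
at 56 resp. 95 rational parameter vectors, `t* = 0` in all `108 + 8 300 + 996` instances).  We record the conjecture that it is always
feasible (`TransportCertConjecture`, an OBLIGATION, not a fact) and prove that it implies Kahn's Conjecture 5 outright
(`kahnConjecture_of_transportCertConjecture`: take the block to be all coordinates), together with the two trivial pattern events
(`transportCert_empty`, `transportCert_univ`). [this work]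
-/

noncomputable section

open scoped Classical

namespace Summit.CriticalPhenomena.PercolationContinuityZ3.Theorems

namespace SahiTransportCert

open Finset
open SahiHittingSlot
open Literature.Combinatorics.Sahi2008
open Literature.Probability.LatticeModels (exists_monotoneCoupling_of_upperSets_le prodBernoulli sahiE3)
open Literature.Probability.Percolation (DeterminedBy determinedBy_iff)
open Literature.Probability.Percolation.BHK2006 (harris ind_inter)
open Literature.Probability.Percolation.DecisionTree (ind ind_of_mem ind_of_not_mem ind_nonneg)

variable {ι : Type} [Fintype ι] {k : ℕ}

/-! ### The reduced certificate -/

/-- The right-hand side of the transport condition (TC) at a pair of pattern families. [this work] -/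
def tcRHS (q : Fin k → unitInterval) (Hk 𝒳 𝒵 : Set (Set (Fin k))) : ℝ :=
  (2 - pr q Hk) * (pr q (𝒳 ∩ 𝒵) - pr q 𝒳 * pr q 𝒵 - pr q (Hkᶜ ∩ (𝒳 ∩ 𝒵)))
    + pr q 𝒳 * pr q (Hkᶜ ∩ 𝒵) + pr q 𝒵 * pr q (Hkᶜ ∩ 𝒳)

/-- **The reduced (`ρ`-form) transport certificate**: a probability vector `ρ` on the pattern event `Hk` with
(a) the capacity bound `θδ·ρ(T) ≤ (2−θ)·w(T)`, (o) `ρ` stochastically above `μ(·|Hkᶜ)` (`w(Hkᶜ ∩ 𝒯) ≤ δ·ρ(𝒯)` on up-sets), and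
(TC) `θδ·ρ(𝒳 ∩ 𝒵) ≤ tcRHS` on pairs of up-sets (`θ = w(Hk)`, `δ = 1 − θ`).  This is the finite linear system censused by exact LP. [this work] -/
def RhoCert (q : Fin k → unitInterval) (Hk : Set (Set (Fin k))) (ρ : Set (Fin k) → ℝ) : Prop :=
  (∀ T, 0 ≤ ρ T) ∧ (∀ T, T ∉ Hk → ρ T = 0) ∧ (∑ T, ρ T = 1) ∧
  (∀ T, pr q Hk * (1 - pr q Hk) * ρ T ≤ (2 - pr q Hk) * bernoulliWeight q T) ∧
  (∀ 𝒯 : Set (Set (Fin k)), IsUpperSet 𝒯 → pr q (Hkᶜ ∩ 𝒯) ≤ (1 - pr q Hk) * ∑ T, ρ T * ind 𝒯 T) ∧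
  (∀ 𝒳 𝒵 : Set (Set (Fin k)), IsUpperSet 𝒳 → IsUpperSet 𝒵 →
    pr q Hk * (1 - pr q Hk) * ∑ T, ρ T * ind (𝒳 ∩ 𝒵) T ≤ tcRHS q Hk 𝒳 𝒵)

/-- `w(Y ∩ 𝒯)` as a weighted indicator sum. [this work] -/
theorem pr_inter_eq_sum (q : Fin k → unitInterval) (Y 𝒯 : Set (Set (Fin k))) :
    pr q (Y ∩ 𝒯) = ∑ T, bernoulliWeight q T * ind Y T * ind 𝒯 T := by
  rw [pr_eq_sum]
  exact sum_congr rfl fun T _ => by rw [ind_inter, mul_assoc]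

/-- A sum over a finset of patterns as an indicator sum. [this work] -/
theorem sum_mem_eq_sum_mul_ind (U : Finset (Set (Fin k))) (f : Set (Fin k) → ℝ) :
    ∑ T ∈ U, f T = ∑ T, f T * ind (↑U : Set (Set (Fin k))) T := by
  rw [← sum_filter_add_sum_filter_not univ (fun T => T ∈ U)]
  have h1 : (univ.filter fun T => T ∈ U) = U := by ext T; simp
  rw [h1, sum_eq_zero (s := univ.filter fun T => ¬ T ∈ U) (fun T hT => by
    rw [ind_of_not_mem (show T ∉ (↑U : Set (Set (Fin k))) from fun h => (mem_filter.1 hT).2 (mem_coe.1 h)), mul_zero]), add_zero]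
  exact sum_congr rfl fun T hT => by rw [ind_of_mem (mem_coe.2 hT), mul_one]

/-- **Reduced certificate ⇒ kernel certificate** (Strassen).  The coupling of `θ·w|_{Hkᶜ}` (below) with `θδ·ρ` (above) furnished by
Strassen's theorem from (o) is a transport certificate. [this work] -/
theorem exists_transportCert_of_rhoCert {q : Fin k → unitInterval} {Hk : Set (Set (Fin k))} {ρ : Set (Fin k) → ℝ}
    (h : RhoCert q Hk ρ) : ∃ Kr, TransportCert q Hk Kr := by
  obtain ⟨hρ0, hρH, hρ1, ha, ho, htc⟩ := h
  set θ := pr q Hk with hθ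
  have hθ0 : 0 ≤ θ := pr_nonneg q Hk
  have hθ1 : θ ≤ 1 := pr_le_one q Hk
  -- the two marginals
  set μ : Set (Fin k) → ℝ := fun S => θ * (bernoulliWeight q S * ind Hkᶜ S) with hμ
  set ν : Set (Fin k) → ℝ := fun T => θ * (1 - θ) * ρ T with hν
  have hμ0 : ∀ S, 0 ≤ μ S := fun S => mul_nonneg hθ0 (mul_nonneg (bw_nonneg q S) (ind_nonneg _ _))
  have hν0 : ∀ T, 0 ≤ ν T := fun T => mul_nonneg (mul_nonneg hθ0 (by linarith)) (hρ0 T)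
  have hmass : ∑ S, μ S = ∑ T, ν T := by
    simp only [hμ, hν]
    rw [← mul_sum, ← mul_sum, hρ1, mul_one]
    congr 1
    have := pr_compl q Hk
    rw [pr_eq_sum] at this
    rw [this]
  have hdom : ∀ U : Finset (Set (Fin k)), IsUpperSet (U : Set (Set (Fin k))) → ∑ S ∈ U, μ S ≤ ∑ T ∈ U, ν T := by
    intro U hU
    rw [sum_mem_eq_sum_mul_ind U μ, sum_mem_eq_sum_mul_ind U ν]
    have e1 : ∑ S, μ S * ind (↑U : Set (Set (Fin k))) S = θ * pr q (Hkᶜ ∩ ↑U) := by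
      rw [pr_inter_eq_sum, mul_sum]
      exact sum_congr rfl fun S _ => by simp only [hμ]; ring
    have e2 : ∑ T, ν T * ind (↑U : Set (Set (Fin k))) T = θ * ((1 - θ) * ∑ T, ρ T * ind (↑U : Set (Set (Fin k))) T) := by
      rw [mul_sum, mul_sum]
      exact sum_congr rfl fun T _ => by simp only [hν]; ring
    rw [e1, e2]
    exact mul_le_mul_of_nonneg_left (ho _ hU) hθ0
  obtain ⟨π, hπ0, hsupp, hrow, hcol⟩ := exists_monotoneCoupling_of_upperSets_le μ ν hμ0 hν0 hmass hdom
  refine ⟨π, hπ0, fun S T hne => hsupp S T hne, fun S T hne hS => hne ?_, fun S T hne => ?_, fun S hS => ?_, fun T => ?_,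
    fun 𝒳 𝒵 h𝒳 h𝒵 => ?_⟩
  · -- sources lie outside `Hk`: the row of a pattern in `Hk` has mass `0`
    have hr : ∑ T, π S T = 0 := by rw [hrow S]; simp only [hμ]; rw [ind_of_not_mem (Set.notMem_compl_iff.2 hS)]; ring
    exact (sum_eq_zero_iff_of_nonneg fun T _ => hπ0 S T).1 hr T (mem_univ T)
  · -- targets lie in `Hk`: the column of a pattern outside `Hk` has mass `0`
    by_contra hT
    have hc : ∑ S, π S T = 0 := by rw [hcol T]; simp only [hν]; rw [hρH T hT, mul_zero]
    exact hne ((sum_eq_zero_iff_of_nonneg fun S _ => hπ0 S T).1 hc S (mem_univ S))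
  · rw [hrow S]; simp only [hμ]; rw [ind_of_mem (show S ∈ Hkᶜ from hS), mul_one]
  · rw [hcol T]; exact ha T
  · calc ∑ S, ∑ T, π S T * ind (𝒳 ∩ 𝒵) T = ∑ T, (∑ S, π S T) * ind (𝒳 ∩ 𝒵) T := by rw [sum_comm]; simp [sum_mul]
      _ = θ * (1 - θ) * ∑ T, ρ T * ind (𝒳 ∩ 𝒵) T := by
          rw [mul_sum]; exact sum_congr rfl fun T _ => by rw [hcol T]; simp only [hν]; ring
      _ ≤ tcRHS q Hk 𝒳 𝒵 := htc 𝒳 𝒵 h𝒳 h𝒵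

/-- **Kernel certificate ⇒ reduced certificate**: the normalised column marginal `ρ = Π(Hkᶜ, ·)/(θδ)` of a transport certificate
satisfies (o), (a), (TC) (nondegenerate case `0 < θ < 1`). [this work] -/
theorem exists_rhoCert_of_transportCert {q : Fin k → unitInterval} {Hk : Set (Set (Fin k))} {Kr : Set (Fin k) → Set (Fin k) → ℝ}
    (h : TransportCert q Hk Kr) (hθ0 : 0 < pr q Hk) (hθ1 : pr q Hk < 1) : ∃ ρ, RhoCert q Hk ρ := by
  set θ := pr q Hk with hθ
  have hθδ : 0 < θ * (1 - θ) := mul_pos hθ0 (by linarith)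
  have hθne : θ ≠ 0 := hθ0.ne'
  have hδne : (1 - θ) ≠ 0 := (sub_pos.2 hθ1).ne'
  -- row structure: rows outside `Hk` carry `θ w(S)`, rows inside `Hk` vanish
  have hrow0 : ∀ S, S ∈ Hk → ∀ T, Kr S T = 0 := fun S hS T => by
    by_contra hne; exact h.offH S T hne hS
  have hcol0 : ∀ T, T ∉ Hk → ∀ S, Kr S T = 0 := fun T hT S => by
    by_contra hne; exact hT (h.memH S T hne)
  have hrows : ∀ S, ∑ T, Kr S T = θ * (bernoulliWeight q S * ind Hkᶜ S) := by
    intro S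
    by_cases hS : S ∈ Hk
    · rw [sum_eq_zero fun T _ => hrow0 S hS T, ind_of_not_mem (Set.notMem_compl_iff.2 hS)]; ring
    · rw [h.row S hS, ind_of_mem (show S ∈ Hkᶜ from hS), mul_one]
  have htot : ∑ T, ∑ S, Kr S T = θ * (1 - θ) := by
    rw [sum_comm, sum_congr rfl fun S _ => hrows S, ← mul_sum, ← pr_compl q Hk, pr_eq_sum]
  refine ⟨fun T => (∑ S, Kr S T) / (θ * (1 - θ)), fun T => div_nonneg (sum_nonneg fun S _ => h.nonneg S T) hθδ.le,
    fun T hT => by show (∑ S, Kr S T) / (θ * (1 - θ)) = 0; rw [sum_eq_zero fun S _ => hcol0 T hT S, zero_div], ?_, fun T => ?_,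
    fun 𝒯 h𝒯 => ?_, fun 𝒳 𝒵 h𝒳 h𝒵 => ?_⟩
  · rw [← sum_div, htot, div_self hθδ.ne']
  · rw [mul_div_cancel₀ _ hθδ.ne']; exact h.col T
  · -- (o): mass shipped into the up-set `𝒯` from `Hkᶜ ∩ 𝒯` stays in `𝒯`
    have e1 : (1 - θ) * ∑ T, (∑ S, Kr S T) / (θ * (1 - θ)) * ind 𝒯 T = (∑ T, (∑ S, Kr S T) * ind 𝒯 T) / θ := by
      rw [mul_sum, sum_div]
      exact sum_congr rfl fun T _ => by field_simp
    rw [e1, le_div_iff₀ hθ0]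
    calc pr q (Hkᶜ ∩ 𝒯) * θ = ∑ S, (∑ T, Kr S T) * ind 𝒯 S := by
          rw [pr_inter_eq_sum, sum_mul]
          exact sum_congr rfl fun S _ => by rw [hrows S]; ring
      _ = ∑ T, ∑ S, Kr S T * ind 𝒯 S := by rw [sum_comm]; exact sum_congr rfl fun S _ => by rw [sum_mul]
      _ ≤ ∑ T, ∑ S, Kr S T * ind 𝒯 T := sum_le_sum fun T _ => sum_le_sum fun S _ => by
          by_cases hne : Kr S T = 0
          · rw [hne, zero_mul, zero_mul]
          · exact mul_le_mul_of_nonneg_left (ind_le_ind_of_imp fun hS => h𝒯 (h.subset S T hne) hS) (h.nonneg S T)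
      _ = ∑ T, (∑ S, Kr S T) * ind 𝒯 T := sum_congr rfl fun T _ => by rw [sum_mul]
  · have e1 : θ * (1 - θ) * ∑ T, (∑ S, Kr S T) / (θ * (1 - θ)) * ind (𝒳 ∩ 𝒵) T = ∑ T, ∑ S, Kr S T * ind (𝒳 ∩ 𝒵) T := by
      rw [mul_sum]
      refine sum_congr rfl fun T _ => ?_
      rw [← sum_mul]
      field_simp
    rw [e1, sum_comm]; exact h.tc 𝒳 𝒵 h𝒳 h𝒵

/-- **Kernel form ⟺ reduced form** (nondegenerate pattern events). [this work] -/
theorem exists_transportCert_iff_exists_rhoCert {q : Fin k → unitInterval} {Hk : Set (Set (Fin k))}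
    (hθ0 : 0 < pr q Hk) (hθ1 : pr q Hk < 1) : (∃ Kr, TransportCert q Hk Kr) ↔ ∃ ρ, RhoCert q Hk ρ :=
  ⟨fun ⟨_, h⟩ => exists_rhoCert_of_transportCert h hθ0 hθ1, fun ⟨_, h⟩ => exists_transportCert_of_rhoCert h⟩

/-- Kahn / Sahi positivity from a reduced certificate: `E₃(1_H, 1_U, 1_V) ≥ 0` for the certified junta slot `H` and all increasing
`U, V`, every dimension. [this work] -/
theorem sahiE_three_nonneg_of_rhoCert (p : ι → unitInterval) (e : Fin k ↪ ι) {H : Set (Set ι)}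
    (hH : DeterminedBy H (Set.range e)) {ρ : Set (Fin k) → ℝ} (hρ : RhoCert (pk e p) (pat e H) ρ)
    {U V : Set (Set ι)} (hU : IsUpperSet U) (hV : IsUpperSet V) :
    0 ≤ sahiE (bernoulliWeight p) 3 ![ind H, ind U, ind V] := by
  obtain ⟨Kr, hKr⟩ := exists_transportCert_of_rhoCert hρ
  exact sahiE_three_nonneg_of_transportCert p e hH hKr hU hV

/-! ### The trivial pattern events -/

/-- The probability of the empty family is `0`. [this work] -/
theorem pr_empty (q : Fin k → unitInterval) : pr q (∅ : Set (Set (Fin k))) = 0 := by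
  rw [pr_eq_sum]; exact sum_eq_zero fun T _ => by rw [ind_of_not_mem (Set.notMem_empty T), mul_zero]

/-- The empty pattern event carries the zero certificate. [this work] -/
theorem transportCert_empty (q : Fin k → unitInterval) : TransportCert q (∅ : Set (Set (Fin k))) (fun _ _ => 0) := by
  refine ⟨fun _ _ => le_rfl, fun _ _ h => (h rfl).elim, fun _ _ h => (h rfl).elim, fun _ _ h => (h rfl).elim, fun S _ => ?_,
    fun T => ?_, fun 𝒳 𝒵 _ _ => ?_⟩
  · rw [sum_const_zero, pr_empty, zero_mul]
  · rw [sum_const_zero, pr_empty, sub_zero]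
    exact mul_nonneg (by norm_num) (bw_nonneg q T)
  · simp only [zero_mul, sum_const_zero, pr_empty, sub_zero, Set.compl_empty, Set.univ_inter]
    nlinarith [pr_nonneg q 𝒳, pr_nonneg q 𝒵, pr_nonneg q (𝒳 ∩ 𝒵)]

/-- Harris' inequality on the pattern cube, in `pr` form. [this work] -/
theorem pr_mul_pr_le_pr_inter (q : Fin k → unitInterval) {𝒳 𝒵 : Set (Set (Fin k))} (h𝒳 : IsUpperSet 𝒳) (h𝒵 : IsUpperSet 𝒵) :
    pr q 𝒳 * pr q 𝒵 ≤ pr q (𝒳 ∩ 𝒵) := by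
  have hH : (∑ T, bernoulliWeight q T * ind 𝒳 T) * (∑ T, bernoulliWeight q T * ind 𝒵 T) ≤
      (∑ T, bernoulliWeight q T) * ∑ T, bernoulliWeight q T * (ind 𝒳 T * ind 𝒵 T) :=
    harris (p_nonneg q) (p_le_one q) (fun T => ind_nonneg _ T) (fun T => ind_nonneg _ T)
      (monotone_ind_of_isUpperSet h𝒳) (monotone_ind_of_isUpperSet h𝒵)
  rw [sum_bernoulliWeight q, one_mul] at hH
  rw [pr_eq_sum, pr_eq_sum, pr_eq_sum]
  simpa only [ind_inter] using hH

/-- The full pattern event carries the zero certificate (the transport condition is Harris' inequality on the pattern cube). [this work] -/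
theorem transportCert_univ (q : Fin k → unitInterval) : TransportCert q (Set.univ : Set (Set (Fin k))) (fun _ _ => 0) := by
  have h1 : pr q (Set.univ : Set (Set (Fin k))) = 1 := pr_univ q
  have h0 : ∀ Y : Set (Set (Fin k)), pr q ((Set.univ : Set (Set (Fin k)))ᶜ ∩ Y) = 0 := fun Y => by
    rw [Set.compl_univ, Set.empty_inter, pr_empty]
  refine ⟨fun _ _ => le_rfl, fun _ _ h => (h rfl).elim, fun _ _ h => (h rfl).elim, fun _ _ h => (h rfl).elim,
    fun S hS => (hS (Set.mem_univ S)).elim, fun T => ?_, fun 𝒳 𝒵 h𝒳 h𝒵 => ?_⟩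
  · rw [sum_const_zero, h1]
    exact mul_nonneg (by norm_num) (bw_nonneg q T)
  · simp only [zero_mul, mul_zero, sum_const_zero, h1, h0, sub_zero, add_zero]
    have hH := pr_mul_pr_le_pr_inter q h𝒳 h𝒵
    nlinarith

/-! ### The transport-certificate conjecture and Kahn's Conjecture 5 -/

/-- **THE TRANSPORT-CERTIFICATE CONJECTURE** (this programme; an OBLIGATION, not a fact): every increasing family of patterns of every
finite cube carries a transport certificate at every parameter vector.  Evidence (exact rational LP, two independent implementations):
all `18` nontrivial up-sets of `2^3` and all `166` of `2^4` at `56` resp. `95` parameter vectors, `9 404` instances, all feasible; closed-form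
certificates for every type on `≤ 3` coordinates are theorems of the companion files.  By `kahnConjecture_of_transportCertConjecture` it
implies Kahn's Conjecture 5 / Sahi's `C₃` for product measures. [this work] [status: open] -/
@[conjecture] def TransportCertConjecture : Prop :=
  ∀ (k : ℕ) (q : Fin k → unitInterval) (Hk : Set (Set (Fin k))), IsUpperSet Hk → ∃ Kr, TransportCert q Hk Kr

omit [Fintype ι] in
/-- Every event is determined by all coordinates. [this work] -/
theorem determinedBy_range_of_surjective {k : ℕ} (e : Fin k ↪ ι) (he : Function.Surjective e) (H : Set (Set ι)) :
    DeterminedBy H (Set.range e) := by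
  rw [Set.range_eq_univ.2 he, determinedBy_iff]
  intro ω ω' hω
  rw [Set.inter_univ, Set.inter_univ] at hω
  rw [hω]

/-- **The transport-certificate conjecture implies Kahn's Conjecture 5** (take the block to be ALL coordinates: then every increasing
event is a junta on the block, and the extension theorem applies with trivial outer sections). [this work] -/
theorem kahnConjecture_of_transportCertConjecture (hT : TransportCertConjecture) : KahnConjecture := by
  intro ι _ p A B C hA hB hC
  -- enumerate the coordinates
  set k := Fintype.card ι
  let e : Fin k ↪ ι := (Fintype.equivFin ι).symm.toEmbedding
  have he : Function.Surjective e := (Fintype.equivFin ι).symm.surjective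
  have hdet : DeterminedBy A (Set.range e) := determinedBy_range_of_surjective e he A
  obtain ⟨Kr, hKr⟩ := hT k (pk e p) (pat e A) (isUpperSet_pat e hA)
  rw [← sahiE_three_ind]
  exact sahiE_three_nonneg_of_transportCert p e hdet hKr hB hC

/-- Pointwise form: under the conjecture, `E₃(1_A, 1_B, 1_C) ≥ 0` for all increasing events of every finite cube. [this work] -/
theorem sahiE3_nonneg_of_transportCertConjecture (hT : TransportCertConjecture) (p : ι → unitInterval) {A B C : Set (Set ι)}
    (hA : IsUpperSet A) (hB : IsUpperSet B) (hC : IsUpperSet C) : 0 ≤ sahiE3 (prodBernoulli p) A B C :=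
  kahnConjecture_of_transportCertConjecture hT ι p A B C hA hB hC

end SahiTransportCert

end Summit.CriticalPhenomena.PercolationContinuityZ3.Theorems
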